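import Summits.QuantumFields.BalabanUV.Beta.RemainderExplicitHistoryDiagonalOneStepMonotone

/-!
# RemainderExplicitHistoryDiagonalOneStepRate — ROAD P3, ORDER-0 PROFILE FAMILY: THE CLOSED FORM AND THE FACTORIAL RATE FOR ONE-STEP MEMORY —
# for two infrared-pinned runs (A: `K` steps, B: `K + n` steps) of `β_{k+1} = b + ρ(1)·min(g_k, |g_k − g_{k−1}|)` the matched discrepancy IS
# `d_j = ρ(1)·(e_{j−1} − e_{K−1})` (`1 ≤ j ≤ K`; `e_i = g^A_i − g^B_{i+n}`), hence `d_j ≤ ρ(1)·((g^A_{j−1})³∕2)·d_{j−1}` — ONE POSITION TOWARDS THE PIN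
# COSTS THE FACTOR `ρ(1)(g^A_{j−1})³∕2 ≤ ρ(1)γ∕(2(1∕g_IR² + b(K−j+1)))` — and, for a pinned family, the continuum coupling at infrared distance `m`
# is reached in the cutoff at the FACTORIAL rate `astar g m − invSq g m t ≤ (m+t)·W·γ · Π_{i=1}^{t} ρ(1)γ∕(2(1∕g_IR² + b(m+i)))`
# (station S-d4p3-g53-1 «exact monotonicity in the position», second file: the rate that the first file's monotone structure makes explicit)

Cell `pub-balaban`, β-function sub-cell, BINDER row D4 «RemainderConst leaves for Bałaban's split» (`HOME/BINDER-OWNERS.md`; owner lineage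
`b2b-balaban-beta-an4`; this file by co-owner #3 lineage `b2b-balaban-beta-d4-p3`, road P3 «the reduction road», generation 53, station
S-d4p3-g53-1, second file; imports the station's first file `RemainderExplicitHistoryDiagonalOneStepMonotone`), β-FLOW TEAM duty (1); FREEZE
(0) honoured (def-free module in road P3's own `RemainderExplicit*` series; no leaf, no interface, no Literature file).  SOURCE OF THE SHAPES
ONLY: [Balaban1987RG1] (0.20) p. 256, (0.31) and Thm 2 p. 259, §5 p. 298.  [folklore] real analysis about ONE explicit toy family (ours).
HONEST FRAMING: *"Discharging BetaPertH makes Bałaban's UV stability UNCONDITIONAL — a real constructive-QFT result; it is NOT the continuum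
limit and NOT the Clay problem."*  THIS FILE DISCHARGES NOTHING OF THE KIND; nothing of Bałaban's (1.22) is asserted or constructed; row D4
class UNCHANGED (critical-path width 0; instance 0∕1; D4 DISCHARGE NO DATE); NOT B12 Thm 2, NOT BetaPertH, NOT continuum, NOT Clay.  HONEST
DEPENDENCY: continuum YM on T⁴ ⇐ BetaPertH ∧ nine spine estimates (0/9 proved); BetaPertH ⇐ (D1) ∧ (D4) ∧ CAP+tail; G-an2-4 gates asym, D1
and NE2/3/4.  ABSOLUTE RULE: nothing is cited as a fact.  All letters NOT-IN-PRINT; `BetaFlowAsPrinted S` records a Markov β_n only.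

WHY.  Generations 48–52 priced the cutoff discrepancy of the toy family by the profile's MISSING AGES (`Σ_a ρ(a)·ω(a; j₀, K)`): for a profile of
bounded memory that local source VANISHES beyond the memory length, and only the two renewal principles (g52's `disc_le_supersolution` ∕
`disc_ge_subsolution`) say that the discrepancy is still positive there — with no explicit size.  For ONE-STEP memory the first file's step
identity `d_j − d_{j+1} = ρ(1)(e_{j−1} − e_j)` telescopes from the pin to the CLOSED FORM `d_j = ρ(1)(e_{j−1} − e_{K−1})` (§1), so the whole
discrepancy at a position is the memory weight times the coupling gap one position ultraviolet of it (minus the last gap before the pin); the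
conversion `e ≤ (g³∕2)·d` (generation 47's `gap_le_cube_mul`) turns this into the one-step contraction `d_j ≤ ρ(1)((g^A_{j−1})³∕2)·d_{j−1}`, whose
factor is at most `ρ(1)γ∕(2(1∕g_IR² + b·(K−j+1)))` by logarithmic asymptotic freedom — the product of these factors over `t` positions is
FACTORIALLY small.  Read at a fixed infrared distance `m` of a pinned family (§2): every extra cutoff step multiplies the distance to the
continuum coupling by at most `ρ(1)γ∕(2(1∕g_IR² + b(m+1)))` while moving the comparison one scale infrared (`astar_sub_invSq_succ_le_mul`), so
`astar g m − invSq g m (n+t) ≤ Π_{i=1}^{t} ρ(1)γ∕(2(1∕g_IR² + b(m+i))) · (astar g (m+t) − invSq g (m+t) n)` and, with generation 47's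
`|invSq − astar| ≤ m·W·γ`, the title's factorial rate.  The lower side (§1 `disc_ge_oneStep`, §2 `astar_sub_invSq_succ_ge`) has the same
one-step structure with generation 48's `mul_min_le_gap` (`e ≥ (g∕8)·min(1, d·g²)`) and the first file's monotonicity (`e_{K−1} ≤ (γ³∕2)d_{K−1} ≤
(γ³∕2)d_j`).  Numerics of record (`HOME/b2b-balaban-beta-d4-p3/g53/numerics/mono_hp1.out`, flat A = 1, ρ(1) = 0.1, g_IR = b = 1, K = 30, n = 1):
`d_{j+1}∕d_j = 2.9·10⁻⁴ … 3.8·10⁻³ = ρ(1)·c_j` to three digits at every position — the closed form is the law, not a bound.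

WHAT IS PROVED ([folklore]; 0 sorry; 0 `def`; one-step memory `ρ(a) = 0` for `a ≥ 2`, `b > 0`, `ρ ≥ 0`).
* §1 TWO PINNED RUNS (A: `K` steps, B: `K + n` steps, positive couplings, pinned): **`disc_eq_rho_mul_gap_sub`** (`1 ≤ j ≤ K` ⇒
  `d_j = ρ(1)(e_{j−1} − e_{K−1})`), `disc_le_rho_mul_gap` (`d_j ≤ ρ(1)e_{j−1}`), **`disc_le_oneStep`** (`d_j ≤ ρ(1)((g^A_{j−1})³∕2)·d_{j−1}`),
  **`disc_ge_oneStep`** (`1 ≤ j < K`, couplings `≤ γ` ⇒ `ρ(1)(g^A_{j−1}∕8)·min(1, d_{j−1}(g^A_{j−1})²) ≤ (1 + ρ(1)γ³∕2)·d_j`).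
* §2 PINNED FAMILY (`g K` the run with `K` steps in ]0,γ], `g K K = g_IR`; `γ > 0`, `Σ_{a<N}ρ(a) ≤ W` for the limits): **`astar_sub_invSq_succ_le`**
  (`astar g m − invSq g m (n+1) ≤ ρ(1)((g (n+1+m) n)³∕2)·(astar g (m+1) − invSq g (m+1) n)`), **`astar_sub_invSq_succ_le_mul`** (the factor
  `≤ ρ(1)γ∕(2(1∕g_IR² + b(m+1)))`), **`astar_sub_invSq_le_prod`** (`astar g m − invSq g m (n+t) ≤ (Π_{i<t} ρ(1)γ∕(2(1∕g_IR² + b(m+1+i)))) ·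
  (astar g (m+t) − invSq g (m+t) n)`), **`astar_sub_invSq_factorial_rate`** (`astar g m − invSq g m t ≤ (m+t)Wγ · Π_{i<t} ρ(1)γ∕(2(1∕g_IR² + b(m+1+i)))`),
  `astar_sub_invSq_succ_ge` (lower: `ρ(1)(g∕8)·min(1, (astar g (m+1) − invSq g (m+1) n)·g²) ≤ (1 + ρ(1)γ³∕2)(astar g m − invSq g m (n+1))`, `g = g (n+1+m) n`).
-/

noncomputable section

open Finset Filter Topology

namespace Summit.QuantumFields.BalabanUV.Beta.RemainderExplicitHistoryDiagonalOneStepRate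

open Literature.MathematicalPhysics.QuantumFieldTheory.Balaban1983to89
open Literature.MathematicalPhysics.QuantumFieldTheory.Balaban1983to89.FlowStep
open Literature.MathematicalPhysics.QuantumFieldTheory.Balaban1983to89.T4CouplingMatching
open Literature.MathematicalPhysics.QuantumFieldTheory.Balaban1983to89.T4ContinuumCoupling
open Summit.QuantumFields.BalabanUV.Beta.RemainderExplicitHistoryDiagonalMonotone
open Summit.QuantumFields.BalabanUV.Beta.RemainderExplicitHistoryDiagonalWeights
open Summit.QuantumFields.BalabanUV.Beta.RemainderExplicitHistoryDiagonalTwoRun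
open Summit.QuantumFields.BalabanUV.Beta.RemainderExplicitHistoryDiagonalWindow
open Summit.QuantumFields.BalabanUV.Beta.RemainderExplicitHistoryDiagonalOneStepMonotone

variable {β : HBeta} {b γ W : ℝ} {ρ : ℕ → ℝ}

/-! ## §1 Two pinned runs with one-step memory: the closed form and the one-step contraction -/

/-- **THE CLOSED FORM.**  One-step memory (`ρ(a) = 0` for `a ≥ 2`, `b > 0`, `ρ ≥ 0`); two runs — A: `K` steps, B: `K + n` steps, positive
couplings — pinned `g^A_K = g^B_{K+n}`.  THEN for `1 ≤ j ≤ K`: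
`1∕(g^B_{j+n})² − 1∕(g^A_j)² = ρ(1)·((g^A_{j−1} − g^B_{j−1+n}) − (g^A_{K−1} − g^B_{K−1+n}))` — the first file's step identity
`d_l − d_{l+1} = ρ(1)(e_{l−1} − e_l)` telescoped from the pin `d_K = 0`. [cite: Balaban1987RG1, (0.20) p.256 and Thm 2 p.259] -/
theorem disc_eq_rho_mul_gap_sub
    (hβ : ∀ (k : ℕ) (p : Fin (k + 1) → ℝ),
      β k p = b + ∑ i : Fin (k + 1), ρ (k - i) * min (p (Fin.last k)) (|p (Fin.last k) - p i|))
    (hb : 0 < b) (hρ0 : ∀ a, 0 ≤ ρ a) (hρ1 : ∀ a, 2 ≤ a → ρ a = 0) {K n : ℕ} {gA gB : ℕ → ℝ} (hA : RGEqH K β gA)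
    (hB : RGEqH (K + n) β gB) (hApos : ∀ k, k ≤ K → 0 < gA k) (hBpos : ∀ k, k ≤ K + n → 0 < gB k) (hpin : gA K = gB (K + n))
    {j : ℕ} (hj1 : 1 ≤ j) (hjK : j ≤ K) :
    1 / (gB (j + n)) ^ 2 - 1 / (gA j) ^ 2
      = ρ 1 * ((gA (j - 1) - gB (j - 1 + n)) - (gA (K - 1) - gB (K - 1 + n))) := by
  set d : ℕ → ℝ := fun j => 1 / (gB (j + n)) ^ 2 - 1 / (gA j) ^ 2 with hd
  set e : ℕ → ℝ := fun i => gA i - gB (i + n) with he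
  have hdK : d K = 0 := by simp [hd, hpin]
  have hstep : ∀ l, 1 ≤ l → l < K → d l - d (l + 1) = ρ 1 * (e (l - 1) - e l) := by
    intro l hl1 hlK
    have h := disc_step_oneStep hβ hb hρ0 hρ1 hA hB hApos hBpos hl1 hlK
    simpa [hd, he, Nat.add_right_comm l 1 n] using h
  -- by induction on the distance `t = K − j` from the pin
  suffices hmain : ∀ t, t + 1 ≤ K → d (K - t) = ρ 1 * (e (K - t - 1) - e (K - 1)) by
    have h := hmain (K - j) (by omega)
    rw [show K - (K - j) = j by omega] at h
    simpa [hd, he] using h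
  intro t
  induction t with
  | zero => intro _; rw [Nat.sub_zero, hdK]; ring
  | succ t ih =>
    intro ht
    have h1 := ih (by omega)
    have h2 := hstep (K - (t + 1)) (by omega) (by omega)
    rw [show K - (t + 1) + 1 = K - t by omega, h1] at h2
    rw [show K - (t + 1) - 1 = K - (t + 1) - 1 from rfl]
    have : d (K - (t + 1)) = ρ 1 * (e (K - t - 1) - e (K - 1)) + ρ 1 * (e (K - (t + 1) - 1) - e (K - (t + 1))) := by
      linarith
    rw [this, show K - (t + 1) = K - t - 1 by omega]
    ring

/-- THE LAST GAP ONLY LOWERS IT: `1∕(g^B_{j+n})² − 1∕(g^A_j)² ≤ ρ(1)·(g^A_{j−1} − g^B_{j−1+n})` for `1 ≤ j ≤ K` (`e_{K−1} ≥ 0` by the maximum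
principle). [cite: Balaban1987RG1, (0.20) p.256 and Thm 2 p.259] -/
theorem disc_le_rho_mul_gap
    (hβ : ∀ (k : ℕ) (p : Fin (k + 1) → ℝ),
      β k p = b + ∑ i : Fin (k + 1), ρ (k - i) * min (p (Fin.last k)) (|p (Fin.last k) - p i|))
    (hb : 0 < b) (hρ0 : ∀ a, 0 ≤ ρ a) (hρ1 : ∀ a, 2 ≤ a → ρ a = 0) {K n : ℕ} {gA gB : ℕ → ℝ} (hA : RGEqH K β gA)
    (hB : RGEqH (K + n) β gB) (hApos : ∀ k, k ≤ K → 0 < gA k) (hBpos : ∀ k, k ≤ K + n → 0 < gB k) (hpin : gA K = gB (K + n))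
    {j : ℕ} (hj1 : 1 ≤ j) (hjK : j ≤ K) :
    1 / (gB (j + n)) ^ 2 - 1 / (gA j) ^ 2 ≤ ρ 1 * (gA (j - 1) - gB (j - 1 + n)) := by
  rw [disc_eq_rho_mul_gap_sub hβ hb hρ0 hρ1 hA hB hApos hBpos hpin hj1 hjK]
  have hdom := invSq_le_invSq_shift_run hβ hb hρ0 hA hB hApos hBpos hpin (K - 1) (by omega)
  have heK : 0 ≤ gA (K - 1) - gB (K - 1 + n) := by
    linarith [le_of_one_div_sq_le (hApos (K - 1) (by omega)) (hBpos (K - 1 + n) (by omega)) hdom]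
  nlinarith [hρ0 1]

/-- **THE ONE-STEP CONTRACTION.**  Same runs, `1 ≤ j ≤ K`:
`1∕(g^B_{j+n})² − 1∕(g^A_j)² ≤ ρ(1)·((g^A_{j−1})³∕2)·(1∕(g^B_{j−1+n})² − 1∕(g^A_{j−1})²)` — one position towards the pin costs the factor
`ρ(1)(g^A_{j−1})³∕2` (`disc_le_rho_mul_gap` and generation 47's conversion `gap_le_cube_mul`). [cite: Balaban1987RG1, (0.20) p.256 and Thm 2 p.259] -/
theorem disc_le_oneStep
    (hβ : ∀ (k : ℕ) (p : Fin (k + 1) → ℝ),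
      β k p = b + ∑ i : Fin (k + 1), ρ (k - i) * min (p (Fin.last k)) (|p (Fin.last k) - p i|))
    (hb : 0 < b) (hρ0 : ∀ a, 0 ≤ ρ a) (hρ1 : ∀ a, 2 ≤ a → ρ a = 0) {K n : ℕ} {gA gB : ℕ → ℝ} (hA : RGEqH K β gA)
    (hB : RGEqH (K + n) β gB) (hApos : ∀ k, k ≤ K → 0 < gA k) (hBpos : ∀ k, k ≤ K + n → 0 < gB k) (hpin : gA K = gB (K + n))
    {j : ℕ} (hj1 : 1 ≤ j) (hjK : j ≤ K) :
    1 / (gB (j + n)) ^ 2 - 1 / (gA j) ^ 2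
      ≤ ρ 1 * ((gA (j - 1)) ^ 3 / 2) * (1 / (gB (j - 1 + n)) ^ 2 - 1 / (gA (j - 1)) ^ 2) := by
  have h1 := disc_le_rho_mul_gap hβ hb hρ0 hρ1 hA hB hApos hBpos hpin hj1 hjK
  have hdom := invSq_le_invSq_shift_run hβ hb hρ0 hA hB hApos hBpos hpin (j - 1) (by omega)
  have hBA : gB (j - 1 + n) ≤ gA (j - 1) := le_of_one_div_sq_le (hApos (j - 1) (by omega)) (hBpos (j - 1 + n) (by omega)) hdom
  have h2 := gap_le_cube_mul (hBpos (j - 1 + n) (by omega)) hBA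
  have h3 : ρ 1 * (gA (j - 1) - gB (j - 1 + n))
      ≤ ρ 1 * ((gA (j - 1)) ^ 3 / 2 * (1 / (gB (j - 1 + n)) ^ 2 - 1 / (gA (j - 1)) ^ 2)) :=
    mul_le_mul_of_nonneg_left h2 (hρ0 1)
  linarith

/-- **THE ONE-STEP LOWER LAW.**  Same runs with couplings `≤ γ`, `1 ≤ j < K`:
`ρ(1)·(g^A_{j−1}∕8)·min(1, (1∕(g^B_{j−1+n})² − 1∕(g^A_{j−1})²)·(g^A_{j−1})²) ≤ (1 + ρ(1)γ³∕2)·(1∕(g^B_{j+n})² − 1∕(g^A_j)²)` — the closed form with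
generation 48's `mul_min_le_gap` for `e_{j−1}` and, for the last gap, `e_{K−1} ≤ (γ³∕2)d_{K−1} ≤ (γ³∕2)d_j` by the first file's monotonicity.
[cite: Balaban1987RG1, (0.20) p.256 and Thm 2 p.259] -/
theorem disc_ge_oneStep
    (hβ : ∀ (k : ℕ) (p : Fin (k + 1) → ℝ),
      β k p = b + ∑ i : Fin (k + 1), ρ (k - i) * min (p (Fin.last k)) (|p (Fin.last k) - p i|))
    (hb : 0 < b) (hρ0 : ∀ a, 0 ≤ ρ a) (hρ1 : ∀ a, 2 ≤ a → ρ a = 0) {K n : ℕ} {gA gB : ℕ → ℝ} (hA : RGEqH K β gA)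
    (hB : RGEqH (K + n) β gB) (hAbox : ∀ k, k ≤ K → 0 < gA k ∧ gA k ≤ γ) (hBpos : ∀ k, k ≤ K + n → 0 < gB k)
    (hpin : gA K = gB (K + n)) {j : ℕ} (hj1 : 1 ≤ j) (hjK : j < K) :
    ρ 1 * (gA (j - 1) / 8 * min 1 ((1 / (gB (j - 1 + n)) ^ 2 - 1 / (gA (j - 1)) ^ 2) * (gA (j - 1)) ^ 2))
      ≤ (1 + ρ 1 * γ ^ 3 / 2) * (1 / (gB (j + n)) ^ 2 - 1 / (gA j) ^ 2) := by
  have hApos : ∀ k, k ≤ K → 0 < gA k := fun k hk => (hAbox k hk).1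
  have hγ : 0 < γ := lt_of_lt_of_le (hApos 0 (Nat.zero_le K)) (hAbox 0 (Nat.zero_le K)).2
  have hdom := invSq_le_invSq_shift_run hβ hb hρ0 hA hB hApos hBpos hpin
  set d : ℕ → ℝ := fun j => 1 / (gB (j + n)) ^ 2 - 1 / (gA j) ^ 2 with hd
  have hclosed := disc_eq_rho_mul_gap_sub hβ hb hρ0 hρ1 hA hB hApos hBpos hpin hj1 hjK.le
  -- the gap at `j − 1` from below
  have hlow : gA (j - 1) / 8 * min 1 (d (j - 1) * (gA (j - 1)) ^ 2) ≤ gA (j - 1) - gB (j - 1 + n) := by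
    refine mul_min_le_gap (hBpos (j - 1 + n) (by omega)) (hApos (j - 1) (by omega)) ?_ ?_
    · have := hdom (j - 1) (by omega); simp only [hd]; linarith
    · simp only [hd]; linarith
  -- the last gap from above: `e_{K−1} ≤ (γ³∕2)·d_{K−1} ≤ (γ³∕2)·d_j`
  have hBA : gB (K - 1 + n) ≤ gA (K - 1) :=
    le_of_one_div_sq_le (hApos (K - 1) (by omega)) (hBpos (K - 1 + n) (by omega)) (hdom (K - 1) (by omega))
  have hlast1 : gA (K - 1) - gB (K - 1 + n) ≤ (gA (K - 1)) ^ 3 / 2 * d (K - 1) := gap_le_cube_mul (hBpos (K - 1 + n) (by omega)) hBA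
  have hdK1 : 0 ≤ d (K - 1) := by have := hdom (K - 1) (by omega); simp only [hd]; linarith
  have hcube : (gA (K - 1)) ^ 3 ≤ γ ^ 3 := pow_le_pow_left₀ (hApos (K - 1) (by omega)).le (hAbox (K - 1) (by omega)).2 3
  have hlast2 : (gA (K - 1)) ^ 3 / 2 * d (K - 1) ≤ γ ^ 3 / 2 * d (K - 1) := by nlinarith
  -- monotonicity from `j` to `K − 1` (first file, telescoped)
  have hmono : d (K - 1) ≤ d j := by
    have hsucc := disc_succ_le_disc_oneStep hβ hb hρ0 hρ1 hA hB hApos hBpos hpin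
    have key : ∀ t, j + t ≤ K → d (j + t) ≤ d j := by
      intro t
      induction t with
      | zero => intro _; simp
      | succ t ih =>
        intro ht
        have h1 := ih (by omega)
        have h2 := hsucc (j + t) (by omega)
        have h2' : d (j + t + 1) ≤ d (j + t) := by simpa [hd, Nat.add_right_comm (j + t) 1 n] using h2
        rw [show j + (t + 1) = j + t + 1 by omega]
        linarith
    have h := key (K - 1 - j) (by omega)
    rwa [show j + (K - 1 - j) = K - 1 by omega] at h
  have hdj : d j = ρ 1 * ((gA (j - 1) - gB (j - 1 + n)) - (gA (K - 1) - gB (K - 1 + n))) := by simpa [hd] using hclosed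
  show ρ 1 * (gA (j - 1) / 8 * min 1 (d (j - 1) * gA (j - 1) ^ 2)) ≤ (1 + ρ 1 * γ ^ 3 / 2) * d j
  have hρ := hρ0 1
  have k1 := mul_le_mul_of_nonneg_left hlow hρ
  have k2 := mul_le_mul_of_nonneg_left (hlast1.trans hlast2) hρ
  have k3 : ρ 1 * (γ ^ 3 / 2 * d (K - 1)) ≤ ρ 1 * (γ ^ 3 / 2 * d j) :=
    mul_le_mul_of_nonneg_left (mul_le_mul_of_nonneg_left hmono (by positivity)) hρ
  have k4 : d j = ρ 1 * (gA (j - 1) - gB (j - 1 + n)) - ρ 1 * (gA (K - 1) - gB (K - 1 + n)) := by rw [hdj]; ring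
  have e1 : (1 + ρ 1 * γ ^ 3 / 2) * d j = d j + ρ 1 * (γ ^ 3 / 2 * d j) := by ring
  rw [e1]
  linarith

/-! ## §2 Pinned family with one-step memory: the factorial rate in the cutoff -/

/-- **ONE CUTOFF STEP COSTS `ρ(1)g³∕2` AT THE NEXT INFRARED DISTANCE.**  A pinned family of runs with one-step memory (`ρ(a) = 0` for `a ≥ 2`,
`b > 0`, `ρ ≥ 0`, `Σ_{a<N} ρ(a) ≤ W`; `g K` the run with `K` steps in ]0,γ], `g K K = g_IR`): for all `m, n`,
`astar g m − invSq g m (n+1) ≤ ρ(1)·((g (n+1+m) n)³∕2)·(astar g (m+1) − invSq g (m+1) n)` — `disc_le_oneStep` at position `n + 1` of the pair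
(`g (n+1+m)`, `g (n+1+m+N)`), `N → ∞` by generation 47's `continuum_monotone`. [cite: Balaban1987RG1, (0.20) p.256, (0.31) and Thm 2 p.259] -/
theorem astar_sub_invSq_succ_le
    (hβ : ∀ (k : ℕ) (p : Fin (k + 1) → ℝ),
      β k p = b + ∑ i : Fin (k + 1), ρ (k - i) * min (p (Fin.last k)) (|p (Fin.last k) - p i|))
    (hb : 0 < b) (hγ : 0 < γ) (hρ0 : ∀ a, 0 ≤ ρ a) (hρW : ∀ n, ∑ a ∈ range n, ρ a ≤ W) (hρ1 : ∀ a, 2 ≤ a → ρ a = 0)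
    {g : ℕ → ℕ → ℝ} {gIR : ℝ} (hrun : ∀ K, RGEqH K β (g K)) (hbox : ∀ K i, i ≤ K → 0 < g K i ∧ g K i ≤ γ)
    (hpin : ∀ K, g K K = gIR) (m n : ℕ) :
    astar g m - invSq g m (n + 1) ≤ ρ 1 * ((g (n + 1 + m) n) ^ 3 / 2) * (astar g (m + 1) - invSq g (m + 1) n) := by
  have hlim := (continuum_monotone hβ hb hγ hρ0 hρW hrun hbox hpin).1
  have hpair : ∀ N, invSq g m (n + 1 + N) - invSq g m (n + 1)
      ≤ ρ 1 * ((g (n + 1 + m) n) ^ 3 / 2) * (invSq g (m + 1) (n + N) - invSq g (m + 1) n) := by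
    intro N
    have hA : RGEqH (n + 1 + m) β (g (n + 1 + m)) := hrun _
    have hB : RGEqH (n + 1 + m + N) β (g (n + 1 + m + N)) := hrun _
    have hpin' : g (n + 1 + m) (n + 1 + m) = g (n + 1 + m + N) (n + 1 + m + N) := by rw [hpin, hpin]
    have h := disc_le_oneStep hβ hb hρ0 hρ1 hA hB (fun k hk => (hbox _ k hk).1) (fun k hk => (hbox _ k hk).1) hpin'
      (j := n + 1) (by omega) (by omega)
    rw [show n + 1 - 1 = n by omega] at h
    have e1 : invSq g m (n + 1 + N) = 1 / (g (n + 1 + m + N) (n + 1 + N)) ^ 2 := by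
      rw [invSq_def, show n + 1 + N + m = n + 1 + m + N by omega]
    have e2 : invSq g m (n + 1) = 1 / (g (n + 1 + m) (n + 1)) ^ 2 := by rw [invSq_def]
    have e3 : invSq g (m + 1) (n + N) = 1 / (g (n + 1 + m + N) (n + N)) ^ 2 := by
      rw [invSq_def, show n + N + (m + 1) = n + 1 + m + N by omega]
    have e4 : invSq g (m + 1) n = 1 / (g (n + 1 + m) n) ^ 2 := by
      rw [invSq_def, show n + (m + 1) = n + 1 + m by omega]
    rw [e1, e2, e3, e4]
    exact h
  have h1 : Tendsto (fun N => invSq g m (n + 1 + N) - invSq g m (n + 1)) atTop (𝓝 (astar g m - invSq g m (n + 1))) :=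
    ((hlim m).comp (tendsto_atTop_atTop_of_monotone (fun a b hab => by omega) fun N => ⟨N, by omega⟩)).sub
      tendsto_const_nhds
  have h2 : Tendsto (fun N => ρ 1 * ((g (n + 1 + m) n) ^ 3 / 2) * (invSq g (m + 1) (n + N) - invSq g (m + 1) n)) atTop
      (𝓝 (ρ 1 * ((g (n + 1 + m) n) ^ 3 / 2) * (astar g (m + 1) - invSq g (m + 1) n))) :=
    (((hlim (m + 1)).comp (tendsto_atTop_atTop_of_monotone (fun a b hab => by omega) fun N => ⟨N, by omega⟩)).sub
      tendsto_const_nhds).const_mul _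
  exact le_of_tendsto_of_tendsto' h1 h2 hpair

/-- **THE CONTRACTION FACTOR BY ASYMPTOTIC FREEDOM.**  Same family: for all `m, n`,
`astar g m − invSq g m (n+1) ≤ (ρ(1)·γ∕(2·(1∕g_IR² + b(m+1))))·(astar g (m+1) − invSq g (m+1) n)` — the coupling `g (n+1+m) n` sits at infrared
distance `m + 1`, so `g ≤ γ` and `g² ≤ 1∕(1∕g_IR² + b(m+1))` (generation 47's `prof_le_invSq_orderZero`). [cite: Balaban1987RG1, (0.20) p.256, (0.31) and Thm 2 p.259] -/
theorem astar_sub_invSq_succ_le_mul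
    (hβ : ∀ (k : ℕ) (p : Fin (k + 1) → ℝ),
      β k p = b + ∑ i : Fin (k + 1), ρ (k - i) * min (p (Fin.last k)) (|p (Fin.last k) - p i|))
    (hb : 0 < b) (hγ : 0 < γ) (hρ0 : ∀ a, 0 ≤ ρ a) (hρW : ∀ n, ∑ a ∈ range n, ρ a ≤ W) (hρ1 : ∀ a, 2 ≤ a → ρ a = 0)
    {g : ℕ → ℕ → ℝ} {gIR : ℝ} (hrun : ∀ K, RGEqH K β (g K)) (hbox : ∀ K i, i ≤ K → 0 < g K i ∧ g K i ≤ γ)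
    (hpin : ∀ K, g K K = gIR) (m n : ℕ) :
    astar g m - invSq g m (n + 1)
      ≤ (ρ 1 * γ / (2 * (1 / gIR ^ 2 + b * ((m + 1 : ℕ) : ℝ)))) * (astar g (m + 1) - invSq g (m + 1) n) := by
  have h := astar_sub_invSq_succ_le hβ hb hγ hρ0 hρW hρ1 hrun hbox hpin m n
  have hlim := (continuum_monotone hβ hb hγ hρ0 hρW hrun hbox hpin).1
  have hmono := invSq_mono hβ hb hρ0 hrun hbox hpin (m + 1)
  have hD : 0 ≤ astar g (m + 1) - invSq g (m + 1) n := by linarith [hmono.ge_of_tendsto (hlim (m + 1)) n]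
  set x : ℝ := g (n + 1 + m) n with hx
  have hxpos : 0 < x := (hbox _ n (by omega)).1
  have hxγ : x ≤ γ := (hbox _ n (by omega)).2
  have hgIR : 0 < gIR := by have := (hbox 0 0 le_rfl).1; rwa [hpin] at this
  have hP : 0 < 1 / gIR ^ 2 + b * ((m + 1 : ℕ) : ℝ) := by positivity
  -- `x² ≤ 1∕(1∕g_IR² + b(m+1))` from the logarithmic floor of the recursion variable at infrared distance `m + 1`
  have hfloor := prof_le_invSq_orderZero hβ hρ0 hrun hbox hpin (m + 1) n
  have hinv : invSq g (m + 1) n = 1 / x ^ 2 := by rw [invSq_def, hx, show n + (m + 1) = n + 1 + m by omega]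
  rw [hinv] at hfloor
  have hx2 : x ^ 2 ≤ 1 / (1 / gIR ^ 2 + b * ((m + 1 : ℕ) : ℝ)) := by
    rw [le_div_iff₀ hP]
    have := mul_le_mul_of_nonneg_left hfloor (pow_pos hxpos 2).le
    rwa [mul_one_div, div_self (pow_pos hxpos 2).ne'] at this
  have hx3 : x ^ 3 ≤ γ * (1 / (1 / gIR ^ 2 + b * ((m + 1 : ℕ) : ℝ))) := by
    rw [pow_succ']
    exact mul_le_mul hxγ hx2 (pow_pos hxpos 2).le hγ.le
  have hfac : ρ 1 * (x ^ 3 / 2) ≤ ρ 1 * γ / (2 * (1 / gIR ^ 2 + b * ((m + 1 : ℕ) : ℝ))) := by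
    have := mul_le_mul_of_nonneg_left hx3 (hρ0 1)
    rw [show ρ 1 * γ / (2 * (1 / gIR ^ 2 + b * ((m + 1 : ℕ) : ℝ))) = ρ 1 * (γ * (1 / (1 / gIR ^ 2 + b * ((m + 1 : ℕ) : ℝ)))) / 2 by
      field_simp]
    linarith
  exact h.trans (mul_le_mul_of_nonneg_right hfac hD)

/-- **THE PRODUCT LAW.**  Same family: for all `m, n, t`,
`astar g m − invSq g m (n+t) ≤ (Π_{i<t} ρ(1)γ∕(2(1∕g_IR² + b(m+1+i)))) · (astar g (m+t) − invSq g (m+t) n)` — `t` cutoff steps cost the product of the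
contraction factors at the infrared distances `m+1, …, m+t`. [cite: Balaban1987RG1, (0.20) p.256, (0.31) and Thm 2 p.259] -/
theorem astar_sub_invSq_le_prod
    (hβ : ∀ (k : ℕ) (p : Fin (k + 1) → ℝ),
      β k p = b + ∑ i : Fin (k + 1), ρ (k - i) * min (p (Fin.last k)) (|p (Fin.last k) - p i|))
    (hb : 0 < b) (hγ : 0 < γ) (hρ0 : ∀ a, 0 ≤ ρ a) (hρW : ∀ n, ∑ a ∈ range n, ρ a ≤ W) (hρ1 : ∀ a, 2 ≤ a → ρ a = 0)
    {g : ℕ → ℕ → ℝ} {gIR : ℝ} (hrun : ∀ K, RGEqH K β (g K)) (hbox : ∀ K i, i ≤ K → 0 < g K i ∧ g K i ≤ γ)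
    (hpin : ∀ K, g K K = gIR) (m n t : ℕ) :
    astar g m - invSq g m (n + t)
      ≤ (∏ i ∈ range t, ρ 1 * γ / (2 * (1 / gIR ^ 2 + b * ((m + 1 + i : ℕ) : ℝ)))) * (astar g (m + t) - invSq g (m + t) n) := by
  have hgIR : 0 < gIR := by have := (hbox 0 0 le_rfl).1; rwa [hpin] at this
  have hθ : ∀ k : ℕ, 0 ≤ ρ 1 * γ / (2 * (1 / gIR ^ 2 + b * (k : ℝ))) := fun k => by
    have := hρ0 1; positivity
  induction t generalizing m n with
  | zero => simp
  | succ t ih =>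
    -- peel off the first cutoff step (at infrared distance `m + 1`), then the remaining `t` from `m + 1`
    have h1 := astar_sub_invSq_succ_le_mul hβ hb hγ hρ0 hρW hρ1 hrun hbox hpin m (n + t)
    have h2 := ih (m + 1) n
    rw [show n + (t + 1) = n + t + 1 by omega, Finset.prod_range_succ', show m + (t + 1) = m + 1 + t by omega]
    have e : ∀ i, ((m + 1 + (i + 1) : ℕ) : ℝ) = ((m + 1 + 1 + i : ℕ) : ℝ) := fun i => by push_cast; ring
    simp_rw [e]
    calc astar g m - invSq g m (n + t + 1)
        ≤ ρ 1 * γ / (2 * (1 / gIR ^ 2 + b * ((m + 1 : ℕ) : ℝ))) * (astar g (m + 1) - invSq g (m + 1) (n + t)) := h1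
      _ ≤ ρ 1 * γ / (2 * (1 / gIR ^ 2 + b * ((m + 1 : ℕ) : ℝ)))
            * ((∏ i ∈ range t, ρ 1 * γ / (2 * (1 / gIR ^ 2 + b * ((m + 1 + 1 + i : ℕ) : ℝ))))
              * (astar g (m + 1 + t) - invSq g (m + 1 + t) n)) := mul_le_mul_of_nonneg_left h2 (hθ _)
      _ = (∏ i ∈ range t, ρ 1 * γ / (2 * (1 / gIR ^ 2 + b * ((m + 1 + 1 + i : ℕ) : ℝ))))
            * (ρ 1 * γ / (2 * (1 / gIR ^ 2 + b * ((m + 1 + 0 : ℕ) : ℝ))))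
            * (astar g (m + 1 + t) - invSq g (m + 1 + t) n) := by rw [Nat.add_zero]; ring

/-- **THE FACTORIAL RATE OF THE CONTINUUM COUPLING FOR ONE-STEP MEMORY.**  Same family: for every infrared distance `m` and every cutoff `t`,
`0 ≤ astar g m − invSq g m t ≤ (m + t)·W·γ · Π_{i<t} ρ(1)γ∕(2(1∕g_IR² + b(m+1+i)))` — the product law from the cutoff `0` and generation 47's
`|invSq g (m+t) 0 − astar g (m+t)| ≤ (m+t)Wγ`.  Since `ρ(1)γ ≤ Wγ < b` in the family's regime each factor is `< 1∕(2(m+1+i))`: the continuum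
coupling is reached faster than `2^{−t}·m!∕(m+t)!`. [cite: Balaban1987RG1, (0.20) p.256, (0.31) and Thm 2 p.259] -/
theorem astar_sub_invSq_factorial_rate
    (hβ : ∀ (k : ℕ) (p : Fin (k + 1) → ℝ),
      β k p = b + ∑ i : Fin (k + 1), ρ (k - i) * min (p (Fin.last k)) (|p (Fin.last k) - p i|))
    (hb : 0 < b) (hγ : 0 < γ) (hρ0 : ∀ a, 0 ≤ ρ a) (hρW : ∀ n, ∑ a ∈ range n, ρ a ≤ W) (hρ1 : ∀ a, 2 ≤ a → ρ a = 0)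
    {g : ℕ → ℕ → ℝ} {gIR : ℝ} (hrun : ∀ K, RGEqH K β (g K)) (hbox : ∀ K i, i ≤ K → 0 < g K i ∧ g K i ≤ γ)
    (hpin : ∀ K, g K K = gIR) (m t : ℕ) :
    0 ≤ astar g m - invSq g m t
      ∧ astar g m - invSq g m t
          ≤ ((m + t : ℕ) : ℝ) * W * γ * ∏ i ∈ range t, ρ 1 * γ / (2 * (1 / gIR ^ 2 + b * ((m + 1 + i : ℕ) : ℝ))) := by
  have hcm := continuum_monotone hβ hb hγ hρ0 hρW hrun hbox hpin
  have hmono := invSq_mono hβ hb hρ0 hrun hbox hpin m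
  have hgIR : 0 < gIR := by have := (hbox 0 0 le_rfl).1; rwa [hpin] at this
  refine ⟨by linarith [hmono.ge_of_tendsto (hcm.1 m) t], ?_⟩
  have h := astar_sub_invSq_le_prod hβ hb hγ hρ0 hρW hρ1 hrun hbox hpin m 0 t
  rw [Nat.zero_add] at h
  have hend : astar g (m + t) - invSq g (m + t) 0 ≤ ((m + t : ℕ) : ℝ) * W * γ := by
    have := hcm.2.1 (m + t) 0
    rw [abs_le] at this
    linarith [this.1]
  have hprod : 0 ≤ ∏ i ∈ range t, ρ 1 * γ / (2 * (1 / gIR ^ 2 + b * ((m + 1 + i : ℕ) : ℝ))) :=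
    Finset.prod_nonneg fun i _ => by have := hρ0 1; positivity
  calc astar g m - invSq g m t
      ≤ (∏ i ∈ range t, ρ 1 * γ / (2 * (1 / gIR ^ 2 + b * ((m + 1 + i : ℕ) : ℝ)))) * (astar g (m + t) - invSq g (m + t) 0) := h
    _ ≤ (∏ i ∈ range t, ρ 1 * γ / (2 * (1 / gIR ^ 2 + b * ((m + 1 + i : ℕ) : ℝ)))) * (((m + t : ℕ) : ℝ) * W * γ) :=
        mul_le_mul_of_nonneg_left hend hprod
    _ = ((m + t : ℕ) : ℝ) * W * γ * ∏ i ∈ range t, ρ 1 * γ / (2 * (1 / gIR ^ 2 + b * ((m + 1 + i : ℕ) : ℝ))) := by ring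

/-- THE LOWER SIDE, ONE CUTOFF STEP.  Same family: for all `m, n`, with `x = g (n+1+m) n` (the coupling at infrared distance `m + 1` of the run of
length `n + 1 + m`): `ρ(1)·(x∕8)·min(1, (astar g (m+1) − invSq g (m+1) n)·x²) ≤ (1 + ρ(1)γ³∕2)·(astar g m − invSq g m (n+1))` — `disc_ge_oneStep`
at position `n + 1` of the pairs (`g (n+1+m)`, `g (n+1+m+N)`), `N → ∞`. [cite: Balaban1987RG1, (0.20) p.256, (0.31) and Thm 2 p.259] -/
theorem astar_sub_invSq_succ_ge
    (hβ : ∀ (k : ℕ) (p : Fin (k + 1) → ℝ),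
      β k p = b + ∑ i : Fin (k + 1), ρ (k - i) * min (p (Fin.last k)) (|p (Fin.last k) - p i|))
    (hb : 0 < b) (hγ : 0 < γ) (hρ0 : ∀ a, 0 ≤ ρ a) (hρW : ∀ n, ∑ a ∈ range n, ρ a ≤ W) (hρ1 : ∀ a, 2 ≤ a → ρ a = 0)
    {g : ℕ → ℕ → ℝ} {gIR : ℝ} (hrun : ∀ K, RGEqH K β (g K)) (hbox : ∀ K i, i ≤ K → 0 < g K i ∧ g K i ≤ γ)
    (hpin : ∀ K, g K K = gIR) {m : ℕ} (hm : 1 ≤ m) (n : ℕ) :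
    ρ 1 * (g (n + 1 + m) n / 8 * min 1 ((astar g (m + 1) - invSq g (m + 1) n) * (g (n + 1 + m) n) ^ 2))
      ≤ (1 + ρ 1 * γ ^ 3 / 2) * (astar g m - invSq g m (n + 1)) := by
  have hlim := (continuum_monotone hβ hb hγ hρ0 hρW hrun hbox hpin).1
  set x : ℝ := g (n + 1 + m) n with hx
  have hpair : ∀ N, ρ 1 * (x / 8 * min 1 ((invSq g (m + 1) (n + N) - invSq g (m + 1) n) * x ^ 2))
      ≤ (1 + ρ 1 * γ ^ 3 / 2) * (invSq g m (n + 1 + N) - invSq g m (n + 1)) := by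
    intro N
    have hA : RGEqH (n + 1 + m) β (g (n + 1 + m)) := hrun _
    have hB : RGEqH (n + 1 + m + N) β (g (n + 1 + m + N)) := hrun _
    have hpin' : g (n + 1 + m) (n + 1 + m) = g (n + 1 + m + N) (n + 1 + m + N) := by rw [hpin, hpin]
    have h := disc_ge_oneStep hβ hb hρ0 hρ1 hA hB (hbox _) (fun k hk => (hbox _ k hk).1) hpin' (j := n + 1) (by omega)
      (by omega)
    rw [show n + 1 - 1 = n by omega] at h
    have e1 : invSq g m (n + 1 + N) = 1 / (g (n + 1 + m + N) (n + 1 + N)) ^ 2 := by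
      rw [invSq_def, show n + 1 + N + m = n + 1 + m + N by omega]
    have e2 : invSq g m (n + 1) = 1 / (g (n + 1 + m) (n + 1)) ^ 2 := by rw [invSq_def]
    have e3 : invSq g (m + 1) (n + N) = 1 / (g (n + 1 + m + N) (n + N)) ^ 2 := by
      rw [invSq_def, show n + N + (m + 1) = n + 1 + m + N by omega]
    have e4 : invSq g (m + 1) n = 1 / (g (n + 1 + m) n) ^ 2 := by
      rw [invSq_def, show n + (m + 1) = n + 1 + m by omega]
    rw [e1, e2, e3, e4, hx]
    exact h
  have hD : Tendsto (fun N => invSq g (m + 1) (n + N) - invSq g (m + 1) n) atTop (𝓝 (astar g (m + 1) - invSq g (m + 1) n)) :=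
    ((hlim (m + 1)).comp (tendsto_atTop_atTop_of_monotone (fun a b hab => by omega) fun N => ⟨N, by omega⟩)).sub
      tendsto_const_nhds
  have h1 : Tendsto (fun N => ρ 1 * (x / 8 * min 1 ((invSq g (m + 1) (n + N) - invSq g (m + 1) n) * x ^ 2))) atTop
      (𝓝 (ρ 1 * (x / 8 * min 1 ((astar g (m + 1) - invSq g (m + 1) n) * x ^ 2)))) :=
    ((tendsto_const_nhds.min (hD.mul_const _)).const_mul _).const_mul _
  have h2 : Tendsto (fun N => (1 + ρ 1 * γ ^ 3 / 2) * (invSq g m (n + 1 + N) - invSq g m (n + 1))) atTop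
      (𝓝 ((1 + ρ 1 * γ ^ 3 / 2) * (astar g m - invSq g m (n + 1)))) :=
    (((hlim m).comp (tendsto_atTop_atTop_of_monotone (fun a b hab => by omega) fun N => ⟨N, by omega⟩)).sub
      tendsto_const_nhds).const_mul _
  exact le_of_tendsto_of_tendsto' h1 h2 hpair

end Summit.QuantumFields.BalabanUV.Beta.RemainderExplicitHistoryDiagonalOneStepRate
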